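import Mathlib
import HarnessLib
import Literature.Analysis.FluidPDE.LerayPressureDecayReduction

/-!
# `SymmetryModuliCount.FarPastLedger` (crux stmt-NavierStokesRegularity-14060), line
# `uloc-gronwall-transplant`, stub `stub_fplFarShell` (SHELL): the far-shell tail bound

Support file (everything proved, kind = proof) for the lead's skeleton of the line
`uloc-gronwall-transplant`. The far part of the pressure on `B₂(x₁)` has gradient bounded by
`∫_{|y−x₁| ≥ 3} |u|² |y−x₁|⁻⁴ dy`; this file bounds that tail integral, for a continuous
nonnegative density `g` (`= |u(τ)|²`) whose unit-ball integrals are all `≤ B`, by `cS * B` with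
an absolute constant `cS ≥ 0`, and records the integrability of `y ↦ g y / ‖y - x₁‖⁴` off
`B₃(x₁)`. The registered statement carries the covering count (stub COV) and a boundedness
hypothesis on `g` as hypotheses; neither is needed by the proof given here.

Proof: the tree's far-field tail lemma
`Literature.Analysis.FluidPDE.exists_farField_tail_le` (smearing the weight over unit balls,
Tonelli, `∫_{|z| ≥ ρ} |z|⁻⁴ = 3|B₁|/ρ`) with `r = 1`, `L = 3`, `f = ofReal ∘ g`, `C = ofReal B`
gives `∫⁻_{(B₃(x₁))ᶜ} ofReal (g y / ‖y−x₁‖⁴) ≤ K · ofReal (2⁻¹) · ofReal B` with `K < ∞`; the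
finiteness of the right-hand side is the integrability, and `toReal` of the inequality is the
bound with `cS := (K · ofReal 2⁻¹).toReal`.
-/

noncomputable section

open MeasureTheory Metric Set
open scoped ENNReal

set_option linter.dupNamespace false -- nested layout Summit.<S>.<Sub>, Sub = S (D-0017)

namespace Summit.NavierStokesRegularity.NavierStokesRegularity.Theorems

/-- A continuous function on `ℝ³` is integrable on every ball (balls have compact closure). -/
theorem fpl_farShell_integrableOn_ball {g : EuclideanSpace ℝ (Fin 3) → ℝ} (hg : Continuous g)
    (z : EuclideanSpace ℝ (Fin 3)) (r : ℝ) : IntegrableOn g (ball z r) volume :=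
  (hg.continuousOn.integrableOn_compact (isCompact_closedBall z r)).mono_set
    ball_subset_closedBall

/-- The unit-ball bound `∫_{B(z,1)} g ≤ B` of a continuous nonnegative `g`, in `ℝ≥0∞` form:
`∫⁻_{B(z,1)} ofReal ∘ g ≤ ofReal B`. -/
theorem fpl_farShell_lintegral_ball_le {g : EuclideanSpace ℝ (Fin 3) → ℝ} (hg : Continuous g)
    (hg0 : ∀ x, 0 ≤ g x) {B : ℝ} {z : EuclideanSpace ℝ (Fin 3)}
    (hB : ∫ x in ball z 1, g x ≤ B) :
    ∫⁻ x in ball z 1, ENNReal.ofReal (g x) ≤ ENNReal.ofReal B := by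
  rw [← ofReal_integral_eq_lintegral_ofReal (fpl_farShell_integrableOn_ball hg z 1)
    (ae_of_all _ hg0)]
  exact ENNReal.ofReal_le_ofReal hB

/-- **Stub SHELL** (`stub_fplFarShell`) of the line `uloc-gronwall-transplant`: there is an
absolute constant `cS ≥ 0` such that (given the covering count, unused) for every continuous,
nonnegative, bounded `g` on `ℝ³` whose unit-ball integrals are all `≤ B`, the far-shell density
`y ↦ g y / ‖y - x₁‖⁴` is integrable off `B₃(x₁)` with integral `≤ cS * B`. -/
theorem stub_fplFarShell :
    ∃ cS : ℝ, 0 ≤ cS ∧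
    ((∀ (ρ : ℝ), 1 ≤ ρ → ∀ (g : EuclideanSpace ℝ (Fin 3) → ℝ), Continuous g → (∀ x, 0 ≤ g x) →
      ∀ (B : ℝ) (x₁ : EuclideanSpace ℝ (Fin 3)),
      (∀ z : EuclideanSpace ℝ (Fin 3), ∫ x in Metric.ball z 1, g x ≤ B) →
      ∫ x in Metric.ball x₁ ρ, g x ≤ 125 * ρ ^ 3 * B) →
    ∀ (g : EuclideanSpace ℝ (Fin 3) → ℝ), Continuous g → (∀ x, 0 ≤ g x) → (∃ M : ℝ, ∀ x, g x ≤ M) →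
    ∀ (B : ℝ) (x₁ : EuclideanSpace ℝ (Fin 3)),
    (∀ z : EuclideanSpace ℝ (Fin 3), ∫ x in Metric.ball z 1, g x ≤ B) →
      MeasureTheory.IntegrableOn (fun y => g y / ‖y - x₁‖ ^ 4) (Metric.ball x₁ 3)ᶜ
          MeasureTheory.volume ∧
        ∫ y in (Metric.ball x₁ 3)ᶜ, g y / ‖y - x₁‖ ^ 4 ≤ cS * B) := by
  obtain ⟨K, hKtop, hK⟩ :=
    Literature.Analysis.FluidPDE.exists_farField_tail_le (r := (1 : ℝ)) one_pos
  refine ⟨(K * ENNReal.ofReal ((3 - 1 : ℝ)⁻¹)).toReal, ENNReal.toReal_nonneg, ?_⟩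
  intro _hcov g hg hg0 _hM B x₁ hB
  -- `B` is nonnegative, since `0 ≤ ∫_{B(x₁,1)} g ≤ B`
  have hB0 : 0 ≤ B :=
    le_trans (setIntegral_nonneg measurableSet_ball fun x _ => hg0 x) (hB x₁)
  have hmeas : Measurable g := hg.measurable
  -- the tail bound in `ℝ≥0∞`
  have htail := hK (fun y => ENNReal.ofReal (g y)) hmeas.ennreal_ofReal.aemeasurable
    (ENNReal.ofReal B) (fun z => fpl_farShell_lintegral_ball_le hg hg0 (hB z)) x₁ 3
    (by norm_num)
  have hint : ∀ y : EuclideanSpace ℝ (Fin 3),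
      ENNReal.ofReal (g y) * ENNReal.ofReal ((‖y - x₁‖ ^ 4)⁻¹) =
        ENNReal.ofReal (g y / ‖y - x₁‖ ^ 4) := fun y => by
    rw [← ENNReal.ofReal_mul (hg0 y), div_eq_mul_inv]
  simp only [hint] at htail
  have hfin : K * ENNReal.ofReal ((3 - 1 : ℝ)⁻¹) * ENNReal.ofReal B ≠ ∞ :=
    ENNReal.mul_ne_top (ENNReal.mul_ne_top hKtop ENNReal.ofReal_ne_top) ENNReal.ofReal_ne_top
  have hnn : ∀ y : EuclideanSpace ℝ (Fin 3), 0 ≤ g y / ‖y - x₁‖ ^ 4 := fun y =>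
    div_nonneg (hg0 y) (by positivity)
  have hsm : AEStronglyMeasurable (fun y : EuclideanSpace ℝ (Fin 3) => g y / ‖y - x₁‖ ^ 4)
      (volume.restrict (ball x₁ 3)ᶜ) :=
    (hmeas.div ((continuous_norm.comp (continuous_id.sub continuous_const)).pow 4).measurable)
      |>.aestronglyMeasurable
  have hInt : IntegrableOn (fun y => g y / ‖y - x₁‖ ^ 4) (ball x₁ 3)ᶜ volume := by
    refine ⟨hsm, ?_⟩
    rw [hasFiniteIntegral_iff_ofReal (ae_of_all _ hnn)]
    exact lt_of_le_of_lt htail hfin.lt_top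
  refine ⟨hInt, ?_⟩
  rw [integral_eq_lintegral_of_nonneg_ae (ae_of_all _ hnn) hsm]
  calc (∫⁻ y in (ball x₁ 3)ᶜ, ENNReal.ofReal (g y / ‖y - x₁‖ ^ 4)).toReal
      ≤ (K * ENNReal.ofReal ((3 - 1 : ℝ)⁻¹) * ENNReal.ofReal B).toReal :=
        ENNReal.toReal_mono hfin htail
    _ = (K * ENNReal.ofReal ((3 - 1 : ℝ)⁻¹)).toReal * B := by
        rw [ENNReal.toReal_mul, ENNReal.toReal_ofReal hB0]

end Summit.NavierStokesRegularity.NavierStokesRegularity.Theorems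

end
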